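import Literature.Probability.Percolation.QuadCrossingLowerSets
import Literature.Probability.Percolation.QuadCrossingRotationInvariance
import HarnessLib

/-!
# Schramm–Smirnov continuity of crossing events, uniformly on compact families of quads

Topic `Probability/Percolation`; proofs only. The discrete continuity estimate (5.1) of
O. Schramm, S. Smirnov, *On the scaling limits of planar percolation*, Ann. Probab. 39 (2011),
arXiv:1101.5820, §5 — in the tree the conclusion of `Quad.continuity_of_lemma_5_1`
(`QuadCrossingContinuityOfLemma51.lean`) and the hypothesis `hcont` of
`dkkmo_crossing_rotation_invariance_of_schrammSmirnov` (`QuadCrossingRotationInvarianceOfSS.lean`):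
*for every quad `Q₀` and `ε > 0` there are quads `Q' < Q₀ < Q''` and `δ₀ > 0` with
`μ[Q' crossed inside the open edges of δℤ² ∧ Q'' not crossed] ≤ ε` for `0 < δ < δ₀`* — is a
POINTWISE statement in the quad. Consumers that move the quad continuously (all rotations
`e^{iβ} Q` of a fixed quad, `β ∈ [0, 2π]`, in the transfer argument for
`Literature.Probability.Percolation.dkkmo_crossing_rotation_invariance`; perturbation families
`Q₊(t) → Q₀`) need it UNIFORMLY: one `δ₀` for a whole compact family, and brackets `Q' < P' < Q''`
valid for all quads `P'` uniformly close to the members `P` of the family. Since `<`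
(`Quad.StrictlyDominated`) is an open relation, this is a compactness argument (finite subcover +
Lebesgue number), carried out here once:

* `Quad.exists_finset_brackets_of_isCompact` — the abstract core: if every quad `Q₀` has a
  bracket `Q' < Q₀ < Q''` with a property `good Q' Q''`, then a compact set of quads is served by
  FINITELY many good brackets, each member `P` together with its whole `r`-ball for one `r > 0`;
* `Quad.setOf_crossed_and_not_crossed_mono` — the difference events are monotone in the bracket
  (`Q' ≤ P`, `P'' ≤ Q''` give `{P crossed ∧ P'' not} ⊆ {Q' crossed ∧ Q'' not}`);
* `Quad.continuity_uniform_of_isCompact`, `Quad.continuity_uniform_of_continuousOn` — (5.1)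
  uniformly on a compact set of quads / along a continuous family over a compact parameter set:
  one `δ₀ > 0` and one `r > 0` such that every member `P` has a bracket `Q' < P' < Q''` for all
  `P'` with `dist P' P < r`, with `μ[Q' crossed ∧ Q'' not] ≤ ε` for all `0 < δ < δ₀`;
* `Quad.continuity_uniform_pair` — the form consumed by transfer arguments: for all quads
  `P', P''` in the `r`-ball of a member of the family, `μ[P' crossed ∧ P'' not crossed] ≤ ε` for
  `0 < δ < δ₀` (both lie strictly inside the member's bracket; monotonicity).

The measure `μ` on bond configurations is arbitrary (for critical bond percolation on `δℤ²`,
`μ = bondPercolation (zdGraph 2) half`, the hypothesis is literally `hcont`).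

## References

* O. Schramm, S. Smirnov, Ann. Probab. 39 (2011) 1768–1814, arXiv:1101.5820, §1.3 (the order `<`
  on quads is open), §5, eq. (5.1). [SchrammSmirnov2011]
* H. Duminil-Copin, K. K. Kozlowski, D. Krachun, I. Manolescu, M. Oulamara, arXiv:2012.11672,
  Cor. 1.3 and §7.1 (uniformity in the rotation angle). [DKKMO2020Rotational]
-/

noncomputable section

open scoped unitInterval ENNReal
open Set Filter Metric
open _root_.MeasureTheory _root_.Topology
open Literature.Probability.LatticeModels

namespace Literature.Probability.Percolation

namespace QuadCrossing

namespace Quad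

variable {D : Set ℂ}

/-! ### The abstract compactness step -/

/-- **Finitely many brackets serve a compact family, with room.** If every quad `Q₀` admits
quads `Q' < Q₀ < Q''` with `good Q' Q''`, then for every compact set `𝒦` of quads there are a
finite set `T` of good brackets and `r > 0` such that every `P ∈ 𝒦` has a bracket `(Q', Q'') ∈ T`
with `Q' < P' < Q''` for ALL quads `P'` with `dist P' P < r` (openness of `<`,
`isOpen_setOf_strictlyDominated_left/right`, a finite subcover and a Lebesgue number).
[cite: SchrammSmirnov2011, §1.3] -/
theorem exists_finset_brackets_of_isCompact {good : Quad D → Quad D → Prop}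
    (h : ∀ Q₀ : Quad D, ∃ Q' Q'' : Quad D, StrictlyDominated Q' Q₀ ∧ StrictlyDominated Q₀ Q'' ∧ good Q' Q'')
    {𝒦 : Set (Quad D)} (h𝒦 : IsCompact 𝒦) :
    ∃ T : Finset (Quad D × Quad D), (∀ p ∈ T, good p.1 p.2) ∧ ∃ r : ℝ, 0 < r ∧
      ∀ P ∈ 𝒦, ∃ p ∈ T, ∀ P' : Quad D, dist P' P < r →
        StrictlyDominated p.1 P' ∧ StrictlyDominated P' p.2 := by
  classical
  choose Qm Qp hQm hQp hgood using h
  -- the open sets `U Q₀ = {P | Qm Q₀ < P < Qp Q₀}` cover everything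
  set U : Quad D → Set (Quad D) := fun Q₀ => {P | StrictlyDominated (Qm Q₀) P ∧ StrictlyDominated P (Qp Q₀)}
    with hU
  have hUo : ∀ Q₀, IsOpen (U Q₀) := fun Q₀ =>
    (isOpen_setOf_strictlyDominated_right (Qm Q₀)).inter (isOpen_setOf_strictlyDominated_left (Qp Q₀))
  have hcover : 𝒦 ⊆ ⋃ Q₀, U Q₀ := fun P _ => mem_iUnion.2 ⟨P, hQm P, hQp P⟩
  obtain ⟨t, ht⟩ := h𝒦.elim_finite_subcover U hUo hcover
  -- Lebesgue number for the finite subcover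
  have hcover' : 𝒦 ⊆ ⋃ i : t, U i.1 := by
    intro P hP
    obtain ⟨Q₀, hQ₀⟩ := mem_iUnion.1 (ht hP)
    obtain ⟨hQ₀t, hPU⟩ := mem_iUnion.1 hQ₀
    exact mem_iUnion.2 ⟨⟨Q₀, hQ₀t⟩, hPU⟩
  obtain ⟨r, hr, hleb⟩ := lebesgue_number_lemma_of_metric h𝒦 (fun i : t => hUo i.1) hcover'
  refine ⟨t.image fun Q₀ => (Qm Q₀, Qp Q₀), ?_, r, hr, fun P hP => ?_⟩
  · intro p hp
    obtain ⟨Q₀, -, rfl⟩ := Finset.mem_image.1 hp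
    exact hgood Q₀
  · obtain ⟨i, hi⟩ := hleb P hP
    refine ⟨(Qm i.1, Qp i.1), Finset.mem_image.2 ⟨i.1, i.2, rfl⟩, fun P' hP' => ?_⟩
    exact hi (mem_ball.2 hP')

/-! ### Monotonicity of the difference events in the bracket -/

/-- The event "`Q` is crossed inside the open edges of `δℤ²`". [cite: SchrammSmirnov2011, §1.3] -/
theorem setOf_crossed_mono {Q P : Quad D} (h : Dominated Q P) (δ : ℝ) :
    {ω : BondConfig (Site 2) | ∃ K, P.IsCrossing K ∧ K ⊆ openEdgeUnion δ ω} ⊆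
      {ω | ∃ K, Q.IsCrossing K ∧ K ⊆ openEdgeUnion δ ω} := by
  rintro ω ⟨K, hK, hKO⟩
  obtain ⟨K', hK'K, hK'⟩ := h K hK
  exact ⟨K', hK', hK'K.trans hKO⟩

/-- **Monotonicity of `{P crossed ∧ P'' not crossed}` in the bracket**: if `Q' ≤ P` and
`P'' ≤ Q''` then `{P crossed ∧ P'' not} ⊆ {Q' crossed ∧ Q'' not}`. [cite: SchrammSmirnov2011, §1.3] -/
theorem setOf_crossed_and_not_crossed_mono {Q' P P'' Q'' : Quad D} (h₁ : Dominated Q' P)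
    (h₂ : Dominated P'' Q'') (δ : ℝ) :
    {ω : BondConfig (Site 2) | (∃ K, P.IsCrossing K ∧ K ⊆ openEdgeUnion δ ω) ∧
        ¬ ∃ K, P''.IsCrossing K ∧ K ⊆ openEdgeUnion δ ω} ⊆
      {ω | (∃ K, Q'.IsCrossing K ∧ K ⊆ openEdgeUnion δ ω) ∧
        ¬ ∃ K, Q''.IsCrossing K ∧ K ⊆ openEdgeUnion δ ω} := by
  rintro ω ⟨hP, hP''⟩
  exact ⟨setOf_crossed_mono h₁ δ hP, fun hQ'' => hP'' (setOf_crossed_mono h₂ δ hQ'')⟩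

/-! ### (5.1) uniformly on compact families -/

variable {μ : Measure (BondConfig (Site 2))}

/-- **Schramm–Smirnov's (5.1), uniformly on a compact set of quads.** Assume the pointwise
estimate: every quad `Q₀` has a bracket `Q' < Q₀ < Q''` and `δ₀ > 0` with
`μ[Q' crossed ∧ Q'' not crossed] ≤ ε` for `0 < δ < δ₀`. Then for every compact set `𝒦` of quads
there are ONE `δ₀ > 0` and `r > 0` such that every `P ∈ 𝒦` has a bracket `Q' < P' < Q''` valid for
all quads `P'` with `dist P' P < r`, with `μ[Q' crossed ∧ Q'' not crossed] ≤ ε` for all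
`0 < δ < δ₀`. [cite: SchrammSmirnov2011, eq. (5.1)] -/
theorem continuity_uniform_of_isCompact
    (hcont : ∀ (Q₀ : Quad D) (ε : ℝ≥0∞), 0 < ε →
      ∃ Q' Q'' : Quad D, StrictlyDominated Q' Q₀ ∧ StrictlyDominated Q₀ Q'' ∧
        ∃ δ₀ : ℝ, 0 < δ₀ ∧ ∀ δ : ℝ, 0 < δ → δ < δ₀ →
          μ {ω | (∃ K, Q'.IsCrossing K ∧ K ⊆ openEdgeUnion δ ω) ∧
            ¬ ∃ K, Q''.IsCrossing K ∧ K ⊆ openEdgeUnion δ ω} ≤ ε)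
    {𝒦 : Set (Quad D)} (h𝒦 : IsCompact 𝒦) (ε : ℝ≥0∞) (hε : 0 < ε) :
    ∃ δ₀ : ℝ, 0 < δ₀ ∧ ∃ r : ℝ, 0 < r ∧ ∀ P ∈ 𝒦, ∃ Q' Q'' : Quad D,
      (∀ P' : Quad D, dist P' P < r → StrictlyDominated Q' P' ∧ StrictlyDominated P' Q'') ∧
      ∀ δ : ℝ, 0 < δ → δ < δ₀ →
        μ {ω | (∃ K, Q'.IsCrossing K ∧ K ⊆ openEdgeUnion δ ω) ∧
          ¬ ∃ K, Q''.IsCrossing K ∧ K ⊆ openEdgeUnion δ ω} ≤ ε := by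
  classical
  -- the finite family of brackets
  obtain ⟨T, hTgood, r, hr, hT⟩ := exists_finset_brackets_of_isCompact
    (good := fun Q' Q'' => ∃ δ₀ : ℝ, 0 < δ₀ ∧ ∀ δ : ℝ, 0 < δ → δ < δ₀ →
      μ {ω | (∃ K, Q'.IsCrossing K ∧ K ⊆ openEdgeUnion δ ω) ∧
        ¬ ∃ K, Q''.IsCrossing K ∧ K ⊆ openEdgeUnion δ ω} ≤ ε)
    (fun Q₀ => hcont Q₀ ε hε) h𝒦
  -- one `δ₀` below all of theirs
  choose! d hd hbound using hTgood
  set δ₀ : ℝ := (insert 1 (T.image d)).min' (Finset.insert_nonempty _ _) with hδ₀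
  have hδ₀pos : 0 < δ₀ := by
    rw [hδ₀, Finset.lt_min'_iff]
    intro x hx
    rcases Finset.mem_insert.1 hx with rfl | hx
    · exact one_pos
    · obtain ⟨p, hp, rfl⟩ := Finset.mem_image.1 hx
      exact hd p hp
  have hδ₀le : ∀ p ∈ T, δ₀ ≤ d p := fun p hp =>
    Finset.min'_le _ _ (Finset.mem_insert_of_mem (Finset.mem_image.2 ⟨p, hp, rfl⟩))
  refine ⟨δ₀, hδ₀pos, r, hr, fun P hP => ?_⟩
  obtain ⟨p, hpT, hp⟩ := hT P hP
  exact ⟨p.1, p.2, hp, fun δ hδ hδlt => hbound p hpT δ hδ (hδlt.trans_le (hδ₀le p hpT))⟩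

/-- **(5.1) uniformly along a continuous family of quads over a compact parameter set** (e.g. all
rotations `β ↦ e^{iβ} Q`, `β ∈ [0, 2π]`, of one quad). [cite: SchrammSmirnov2011, eq. (5.1)] -/
theorem continuity_uniform_of_continuousOn
    (hcont : ∀ (Q₀ : Quad D) (ε : ℝ≥0∞), 0 < ε →
      ∃ Q' Q'' : Quad D, StrictlyDominated Q' Q₀ ∧ StrictlyDominated Q₀ Q'' ∧
        ∃ δ₀ : ℝ, 0 < δ₀ ∧ ∀ δ : ℝ, 0 < δ → δ < δ₀ →
          μ {ω | (∃ K, Q'.IsCrossing K ∧ K ⊆ openEdgeUnion δ ω) ∧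
            ¬ ∃ K, Q''.IsCrossing K ∧ K ⊆ openEdgeUnion δ ω} ≤ ε)
    {ι : Type*} [TopologicalSpace ι] {S : Set ι} (hS : IsCompact S) {q : ι → Quad D}
    (hq : ContinuousOn q S) (ε : ℝ≥0∞) (hε : 0 < ε) :
    ∃ δ₀ : ℝ, 0 < δ₀ ∧ ∃ r : ℝ, 0 < r ∧ ∀ i ∈ S, ∃ Q' Q'' : Quad D,
      (∀ P' : Quad D, dist P' (q i) < r → StrictlyDominated Q' P' ∧ StrictlyDominated P' Q'') ∧
      ∀ δ : ℝ, 0 < δ → δ < δ₀ →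
        μ {ω | (∃ K, Q'.IsCrossing K ∧ K ⊆ openEdgeUnion δ ω) ∧
          ¬ ∃ K, Q''.IsCrossing K ∧ K ⊆ openEdgeUnion δ ω} ≤ ε := by
  obtain ⟨δ₀, hδ₀, r, hr, h⟩ := continuity_uniform_of_isCompact hcont (hS.image_of_continuousOn hq) ε hε
  exact ⟨δ₀, hδ₀, r, hr, fun i hi => h (q i) ⟨i, hi, rfl⟩⟩

/-- **The uniform estimate read on arbitrary pairs inside the brackets**: with `δ₀, r` as in
`continuity_uniform_of_isCompact`, for every member `P ∈ 𝒦`, all quads `P', P''` in the `r`-ball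
of `P` satisfy `μ[P' crossed ∧ P'' not crossed] ≤ ε` for `0 < δ < δ₀` — no order between `P'`
and `P''` is required, since both lie strictly between the two ends of the bracket of `P`.
This is the form used to compare a moving quad with its perturbations (`P' = e^{iβ} Q`,
`P'' = e^{iβ} Q₊(t)`, `t` small, uniformly in `β`). [cite: SchrammSmirnov2011, eq. (5.1)] -/
theorem continuity_uniform_pair
    (hcont : ∀ (Q₀ : Quad D) (ε : ℝ≥0∞), 0 < ε →
      ∃ Q' Q'' : Quad D, StrictlyDominated Q' Q₀ ∧ StrictlyDominated Q₀ Q'' ∧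
        ∃ δ₀ : ℝ, 0 < δ₀ ∧ ∀ δ : ℝ, 0 < δ → δ < δ₀ →
          μ {ω | (∃ K, Q'.IsCrossing K ∧ K ⊆ openEdgeUnion δ ω) ∧
            ¬ ∃ K, Q''.IsCrossing K ∧ K ⊆ openEdgeUnion δ ω} ≤ ε)
    {𝒦 : Set (Quad D)} (h𝒦 : IsCompact 𝒦) (ε : ℝ≥0∞) (hε : 0 < ε) :
    ∃ δ₀ : ℝ, 0 < δ₀ ∧ ∃ r : ℝ, 0 < r ∧ ∀ P ∈ 𝒦, ∀ P' P'' : Quad D,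
      dist P' P < r → dist P'' P < r → ∀ δ : ℝ, 0 < δ → δ < δ₀ →
        μ {ω | (∃ K, P'.IsCrossing K ∧ K ⊆ openEdgeUnion δ ω) ∧
          ¬ ∃ K, P''.IsCrossing K ∧ K ⊆ openEdgeUnion δ ω} ≤ ε := by
  obtain ⟨δ₀, hδ₀, r, hr, h⟩ := continuity_uniform_of_isCompact hcont h𝒦 ε hε
  refine ⟨δ₀, hδ₀, r, hr, fun P hP P' P'' hP' hP'' δ hδ hδlt => ?_⟩
  obtain ⟨Q', Q'', hbr, hbound⟩ := h P hP
  exact (measure_mono (setOf_crossed_and_not_crossed_mono (hbr P' hP').1.dominated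
    (hbr P'' hP'').2.dominated δ)).trans (hbound δ hδ hδlt)

end Quad

end QuadCrossing

end Literature.Probability.Percolation
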